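import Mathlib
import Summits.Ventures.PercRepro2.TypedPendantA3
import Summits.Ventures.PercRepro2.A3InactiveTypedNR
import Summits.Ventures.PercRepro2.FiveTypedAll

/-!
# The pendant-`a₃` class under typed BHK 1.4 and pendant monotonicity (blind cell PercRepro2,
night-3 g6, 2026-08-25)

`TypedPendantA3.lean` gives the quadratic identity `S₀ + S₂ = S₁ + S₃` of the four typed bases of
a pendant `a₃`-edge and the candidate row (PM) `S₀ ≤ S₁`. Here the isolated base `S₀` is discharged
by p5's `a₃`-inactive theorem (`A3InactiveTyped.typedCount_nonneg_of_a3_inactive'`, CONDITIONAL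
on the named hypothesis `TB14`), so that, conditionally on `TB14` and (PM), the pendant instance's
mixed bases are nonnegative as soon as the base with `a₃ := u` (one typed edge fewer) is:

* **`typedCount_pendant_a3_isolated_nonneg`** (conditional on `TB14`): `0 ≤ S₀`;
* **`typedCount_pendant_a3_nonneg_of_TB14_PM`** (conditional on `TB14` and `PM`): `0 ≤ S₃ → 0 ≤ S₁ ∧ 0 ≤ S₂`;
* **`typedCount_pendant_a3_step`** (conditional on `TB14` and `PM`): the induction step on the number of
  typed edges — if row 2′TRI holds on every instance with `≤ n` typed edges, it holds on every
  instance with `≤ n + 1` typed edges in which `a₃` is a leaf;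
* **`typedCount_pendant_a3_nonneg_of_card_le_six`** (conditional on `TB14` and `PM`): row 2′TRI on
  every instance with `≤ 6` typed edges in which `a₃` is a leaf at an unmarked vertex — the class of
  the cell's boundary object (the 5-cycle `a₁–o–b–a₂–u–a₁` with `a₃` pendant at `u`), from the
  unconditional `|F| ≤ 5` rung (`FiveTypedAll`).
-/

namespace Summit.Ventures.PercRepro2

namespace CovForm

namespace TypedRed

open OneTyped

variable {V : Type} {E : Type} [Fintype V] [DecidableEq V] [Fintype E] [DecidableEq E] {R : Type*}
  [Field R] [LinearOrder R] [IsStrictOrderedRing R]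
variable (ends : E → Sym2 V) (o a₁ a₂ a₃ b : V)

/-- **The isolated base of a pendant `a₃` is nonnegative** (conditional on `TB14`): with the leaf
edge `f` of type `0` every admissible configuration has `f` closed, so `a₃` is inactive on the
support and p5's admissible `a₃`-inactive theorem applies. -/
theorem typedCount_pendant_a3_isolated_nonneg (h : A3InactiveTyped.TB14 R) {f : E} {u : V}
    (hf : ends f = s(a₃, u)) (hleaf : ∀ e, a₃ ∈ ends e → e = f) (h3u : a₃ ≠ u) (h31 : a₃ ≠ a₁)
    (h32 : a₃ ≠ a₂) (F : Finset E) (hfF : f ∈ F) (z : Config E) (τ : E → ℕ)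
    (hτ : ∀ e ∈ F, τ e = 1 ∨ τ e = 2) :
    0 ≤ typedCount F z (Function.update τ f 0)
      (K3 ends o a₁ a₂ a₃ b : Config E → Config E → Config E → R) := by
  rw [typedCount_type_zero F f hfF z _ (Function.update_self f 0 τ)]
  refine A3InactiveTyped.typedCount_nonneg_of_a3_inactive' h ends o a₁ a₂ a₃ b (F.erase f)
    (Function.update z f false) (fun ω hω => ?_) (Function.update τ f 0) (fun e he => ?_)
  · have hωf : ω f = false := by
      rw [hω f (Finset.notMem_erase f F), Function.update_self]
    exact ⟨fun hc => h31 (conn_leaf_closed hf hleaf h3u hωf (conn_symm hc)).symm,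
      fun hc => h32 (conn_leaf_closed hf hleaf h3u hωf (conn_symm hc)).symm⟩
  · rw [Function.update_of_ne (Finset.ne_of_mem_erase he)]
    exact hτ e (Finset.mem_of_mem_erase he)

/-- **The pendant-`a₃` class, conditional on `TB14` and (PM)**: for a typed edge `f = {a₃, u}` whose
end `a₃` is a leaf carrying exactly the mark `a₃`, `u` unmarked, if the base with `f` pinned open
(`a₃ := u`, one typed edge fewer) is nonnegative, then so are the two mixed bases. -/
theorem typedCount_pendant_a3_nonneg_of_TB14_PM (h : A3InactiveTyped.TB14 R) (hPM : PM R)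
    {f : E} {u : V} (hf : ends f = s(a₃, u)) (hleaf : ∀ e, a₃ ∈ ends e → e = f) (h3u : a₃ ≠ u)
    (h3o : a₃ ≠ o) (h31 : a₃ ≠ a₁) (h32 : a₃ ≠ a₂) (h3b : a₃ ≠ b) (huo : u ≠ o) (hu1 : u ≠ a₁)
    (hu2 : u ≠ a₂) (hub : u ≠ b) (F : Finset E) (hfF : f ∈ F) (z : Config E) (τ : E → ℕ)
    (hτ : ∀ e ∈ F, τ e = 1 ∨ τ e = 2)
    (h3 : 0 ≤ typedCount F z (Function.update τ f 3)
        (K3 ends o a₁ a₂ a₃ b : Config E → Config E → Config E → R)) :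
    0 ≤ typedCount F z (Function.update τ f 1)
        (K3 ends o a₁ a₂ a₃ b : Config E → Config E → Config E → R) ∧
      0 ≤ typedCount F z (Function.update τ f 2)
        (K3 ends o a₁ a₂ a₃ b : Config E → Config E → Config E → R) :=
  typedCount_pendant_a3_of_PM ends o a₁ a₂ a₃ b hf hleaf h3u h3o h31 h32 h3b F hfF z τ
    (hPM V E ends o a₁ a₂ a₃ b u f hf hleaf h3u h3o h31 h32 h3b huo hu1 hu2 hub F hfF z τ hτ)
    (typedCount_pendant_a3_isolated_nonneg ends o a₁ a₂ a₃ b h hf hleaf h3u h31 h32 F hfF z τ hτ)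
    h3

/-- Row 2′TRI on every instance (of the given graph and marking) with at most `n` typed edges. -/
def TriLE (n : ℕ) : Prop :=
  ∀ (F : Finset E), F.card ≤ n → ∀ (z : Config E) (τ : E → ℕ), (∀ e ∈ F, τ e = 1 ∨ τ e = 2) →
    0 ≤ typedCount F z τ (K3 ends o a₁ a₂ a₃ b : Config E → Config E → Config E → R)

/-- **The induction step at a pendant `a₃`** (conditional on `TB14` and `PM`): if row 2′TRI holds
with `≤ n` typed edges, then it holds on every instance with `≤ n + 1` typed edges in which `a₃`
is a leaf at an unmarked vertex `u` (its edge `f` typed): the base with `f` pinned open has one typed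
edge fewer. -/
theorem typedCount_pendant_a3_step (h : A3InactiveTyped.TB14 R) (hPM : PM R) {f : E} {u : V}
    (hf : ends f = s(a₃, u)) (hleaf : ∀ e, a₃ ∈ ends e → e = f) (h3u : a₃ ≠ u) (h3o : a₃ ≠ o)
    (h31 : a₃ ≠ a₁) (h32 : a₃ ≠ a₂) (h3b : a₃ ≠ b) (huo : u ≠ o) (hu1 : u ≠ a₁) (hu2 : u ≠ a₂)
    (hub : u ≠ b) {n : ℕ} (hn : TriLE ends o a₁ a₂ a₃ b (R := R) n) (F : Finset E)
    (hF : F.card ≤ n + 1) (hfF : f ∈ F) (z : Config E) (τ : E → ℕ)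
    (hτ : ∀ e ∈ F, τ e = 1 ∨ τ e = 2) :
    0 ≤ typedCount F z τ (K3 ends o a₁ a₂ a₃ b : Config E → Config E → Config E → R) := by
  have h3 : 0 ≤ typedCount F z (Function.update τ f 3)
      (K3 ends o a₁ a₂ a₃ b : Config E → Config E → Config E → R) := by
    rw [typedCount_type_three F f hfF z _ (Function.update_self f 3 τ)]
    refine hn (F.erase f) ?_ (Function.update z f true) (Function.update τ f 3) fun e he => ?_
    · rw [Finset.card_erase_of_mem hfF]; omega
    · rw [Function.update_of_ne (Finset.ne_of_mem_erase he)]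
      exact hτ e (Finset.mem_of_mem_erase he)
  have hboth := typedCount_pendant_a3_nonneg_of_TB14_PM ends o a₁ a₂ a₃ b h hPM hf hleaf h3u h3o
    h31 h32 h3b huo hu1 hu2 hub F hfF z τ hτ h3
  rcases hτ f hfF with h1 | h2
  · have := hboth.1
    rwa [← h1, Function.update_eq_self] at this
  · have := hboth.2
    rwa [← h2, Function.update_eq_self] at this

/-- **Row 2′TRI with `≤ 6` typed edges and a pendant `a₃`** (conditional on `TB14` and `PM`): the
class of the cell's boundary object. Base: the unconditional `|F| ≤ 5` rung (`FiveTypedAll`). -/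
theorem typedCount_pendant_a3_nonneg_of_card_le_six (h : A3InactiveTyped.TB14 R) (hPM : PM R)
    {f : E} {u : V} (hf : ends f = s(a₃, u)) (hleaf : ∀ e, a₃ ∈ ends e → e = f) (h3u : a₃ ≠ u)
    (h3o : a₃ ≠ o) (h31 : a₃ ≠ a₁) (h32 : a₃ ≠ a₂) (h3b : a₃ ≠ b) (huo : u ≠ o) (hu1 : u ≠ a₁)
    (hu2 : u ≠ a₂) (hub : u ≠ b) (F : Finset E) (hF : F.card ≤ 6) (hfF : f ∈ F) (z : Config E)
    (τ : E → ℕ) (hτ : ∀ e ∈ F, τ e = 1 ∨ τ e = 2) :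
    0 ≤ typedCount F z τ (K3 ends o a₁ a₂ a₃ b : Config E → Config E → Config E → R) :=
  typedCount_pendant_a3_step ends o a₁ a₂ a₃ b h hPM hf hleaf h3u h3o h31 h32 h3b huo hu1 hu2 hub
    (fun F' hF' z' τ' hτ' => TwoTyped.typedCount_nonneg_of_card_le_five' ends o a₁ a₂ a₃ b F' hF'
      z' τ' hτ') F hF hfF z τ hτ

end TypedRed

end CovForm

end Summit.Ventures.PercRepro2
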